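import Literature.MathematicalPhysics.QuantumFieldTheory.OSPointPackaging
import Literature.MathematicalPhysics.QuantumFieldTheory.OSPointJointContinuity
import Literature.MathematicalPhysics.QuantumFieldTheory.OSPointTranslation
import Literature.MathematicalPhysics.QuantumFieldTheory.OSTemperedExplicit
import Literature.Analysis.Complex.BochnerArgRegion
import HarnessLib

/-!
# Osterwalder–Schrader II, Theorem 4.3 for a Schwinger family, from the temperedness estimate (4.5)

Topic `Literature/MathematicalPhysics/QuantumFieldTheory`; support file (all proved; the sum-form
bound predicate as a structure; no named facts) for the discharge of (A1)
`OS1975_exists_timeContinuation`. This file assembles the engine (`OSLabelledPieces` …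
`OSTemperedExplicit`, OS II Ch. V–VI.2), its instantiation on Schwinger families
(`OSPointSemigroup`, `OSPointLabelledVectors`, `OSPointRealData`), the joint continuity
(`OSPointJointContinuity`), the translation invariance (`OSPointTranslation`), the global Euclidean
representation (`OSPointGlobalDensity`) and the packaging (`OSPointPackaging`) into:

* `timeContinuation_of_sumBound` — **for a Schwinger family with E0', E1, E2 whose Schwinger
  function values obey the temperedness estimate (4.5) in the sum form with exponent linear in the
  number of points** (`HasPointSumBound`, the printed form of OS II Thm. 4.1 (4.5): constants of
  controlled geometric defect, exponent `k t`, polynomial in the size of the spatial labels), and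
  every `n ≥ 2`, there is `𝔚` with all the properties of (A1): continuous on the time tube,
  holomorphic in the times, invariant under real translations, of OS growth (4.6), and restricting
  to `𝔖ₙ` on all time-ordered test functions (4.4).

The hypothesis `HasPointSumBound` is exactly what remains of OS II Ch. VI.1; the estimate of
`OSTemperedness` (exponent quadratic in `k`) does not suffice for the induction of Ch. VI.2.

## References

* K. Osterwalder, R. Schrader, *Axioms for Euclidean Green's functions II*, Comm. Math. Phys.
  42 (1975) 281–305, §IV.2 Thms. 4.1–4.3, (4.4)–(4.6); Ch. V; Ch. VI. [OsterwalderSchraderCMP1975]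
-/

noncomputable section

open MeasureTheory Set Filter Metric Function Complex
open _root_.Topology
open scoped SchwartzMap InnerProductSpace

namespace Literature.MathematicalPhysics.QuantumFieldTheory

open Literature.MathematicalPhysics.QuantumLattice (SchwingerFamily SpaceTime complexifyPoint euclideanPoint IsTimeOrdered)
open Literature.MathematicalPhysics.QuantumLattice.SchwingerFamily
open Literature.MathematicalPhysics.QuantumLattice.SchwingerFamily.OSSpace
open Literature.MathematicalPhysics.QuantumFieldTheory.OSEnvelope
open Literature.Analysis.Complex

/-! ### Uniqueness of the continuation from the real points -/

section Uniqueness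

variable {k : ℕ}

/-- The open cube of half-width `π/2` is open. [folklore] -/
theorem isOpen_cube : IsOpen {v : Fin k → ℝ | ∀ i, |v i| < Real.pi / 2} := by
  have h : {v : Fin k → ℝ | ∀ i, |v i| < Real.pi / 2} = ⋂ i, {v | |v i| < Real.pi / 2} := by ext v; simp
  rw [h]
  exact isOpen_iInter_of_finite fun i => isOpen_lt (continuous_abs.comp (continuous_apply i)) continuous_const

/-- The open cube is convex. [folklore] -/
theorem convex_cube : Convex ℝ {v : Fin k → ℝ | ∀ i, |v i| < Real.pi / 2} := by
  have h : {v : Fin k → ℝ | ∀ i, |v i| < Real.pi / 2} = ⋂ i, {v | |v i| < Real.pi / 2} := by ext v; simp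
  rw [h]
  refine convex_iInter fun i => ?_
  have : {v : Fin k → ℝ | |v i| < Real.pi / 2} = {v | -(Real.pi / 2) < v i} ∩ {v | v i < Real.pi / 2} := by
    ext v; simp [abs_lt]
  rw [this]
  have hl : IsLinearMap ℝ fun v : Fin k → ℝ => v i := (LinearMap.proj i : (Fin k → ℝ) →ₗ[ℝ] ℝ).isLinear
  exact (convex_halfSpace_gt hl _).inter (convex_halfSpace_lt hl _)

/-- `ℂ₊ᵏ` is the argument region of the open cube. [folklore] -/
theorem setOf_re_pos_eq_argRegion_cube :
    {ζ : Fin k → ℂ | ∀ i, 0 < (ζ i).re} =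
      {ζ | (∀ i, 0 < (ζ i).re) ∧ (fun i => (ζ i).arg) ∈ {v : Fin k → ℝ | ∀ i, |v i| < Real.pi / 2}} := by
  ext ζ
  simp only [mem_setOf_eq]
  exact ⟨fun h => ⟨h, fun i => Complex.abs_arg_lt_pi_div_two_iff.2 (Or.inl (h i))⟩, fun h => h.1⟩

/-- **Uniqueness of the continuation**: two functions holomorphic on `ℂ₊ᵏ` which agree at the
positive real points agree on `ℂ₊ᵏ`. [folklore] -/
theorem eqOn_re_pos_of_eqOn_posReal {f g : (Fin k → ℂ) → ℂ} (hf : DifferentiableOn ℂ f {ζ | ∀ i, 0 < (ζ i).re})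
    (hg : DifferentiableOn ℂ g {ζ | ∀ i, 0 < (ζ i).re})
    (h : ∀ η : Fin k → ℝ, (∀ i, 0 < η i) → f (fun i => (η i : ℂ)) = g (fun i => (η i : ℂ))) :
    EqOn f g {ζ | ∀ i, 0 < (ζ i).re} := by
  rw [setOf_re_pos_eq_argRegion_cube] at hf hg ⊢
  exact eqOn_argRegion_of_eqOn_posReal isOpen_cube convex_cube (fun i => by simpa using Real.pi_pos) (fun v hv => hv) hf hg h

end Uniqueness

/-! ### Joint continuity from compact-uniform bounds -/

section CompactBound

variable {d : ℕ} [NeZero d] {𝔖 : SchwingerFamily (EuclideanSpace ℝ (Fin d))}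
  (hE1 : 𝔖.IsEuclideanCovariant) (hE2 : 𝔖.IsOSReflectionPositive) (hE0 : 𝔖.HasLinearGrowth)

/-- **Joint continuity of a labelled continuation from compact-uniform bounds** (variant of
`continuousOn_labelledTimeContinuation` with the bound hypothesis in compact-uniform form). [cite: OsterwalderSchraderCMP1975, Ch. V.2 p. 294, (5.11)] -/
theorem continuousOn_labelled_of_compactBound {R : ℝ} {k : ℕ}
    {Sext : (Fin (k + 1) → EuclideanSpace ℝ (Fin d)) → (Fin k → ℂ) → ℂ}
    (hhol : ∀ c : Fin (k + 1) → EuclideanSpace ℝ (Fin d), normBall R k c → DifferentiableOn ℂ (Sext c) {Z | ∀ i, 0 < (Z i).re})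
    (hreal : ∀ (c : Fin (k + 1) → EuclideanSpace ℝ (Fin d)), normBall R k c → ∀ ρ : Fin k → ℝ, (∀ i, 0 < ρ i) →
      Sext c (fun i => (ρ i : ℂ)) = pointS₀ hE1 hE2 hE0 k c (fun i => (ρ i : ℂ)))
    (hK : ∀ K ⊆ {Z : Fin k → ℂ | ∀ i, 0 < (Z i).re}, IsCompact K → ∃ M : ℝ,
      ∀ c : Fin (k + 1) → EuclideanSpace ℝ (Fin d), normBall R k c → ∀ W ∈ K, ‖Sext c W‖ ≤ M) :
    ContinuousOn (fun q : (Fin (k + 1) → EuclideanSpace ℝ (Fin d)) × (Fin k → ℂ) => Sext q.1 q.2)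
      ({c | ∀ j, ‖c j‖ < R} ×ˢ {Z | ∀ i, 0 < (Z i).re}) := by
  rw [continuousOn_iff_continuous_restrict, continuous_iff_seqContinuous]
  intro u q hu
  have huq : Tendsto (fun m => (u m).1) atTop (𝓝 q.1) := (continuous_subtype_val.tendsto q).comp hu
  have hc : Tendsto (fun m => (u m).1.1) atTop (𝓝 q.1.1) := (continuous_fst.tendsto _).comp huq
  have hZ : Tendsto (fun m => (u m).1.2) atTop (𝓝 q.1.2) := (continuous_snd.tendsto _).comp huq
  have hcm : ∀ m, normBall R k (u m).1.1 := fun m j => le_of_lt ((u m).2.1 j)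
  have hcq : normBall R k q.1.1 := fun j => le_of_lt (q.2.1 j)
  show Tendsto (fun m => Sext (u m).1.1 (u m).1.2) atTop (𝓝 (Sext q.1.1 q.1.2))
  refine tendsto_of_tendsto_ofReal (F := fun m => Sext (u m).1.1) (f := Sext q.1.1)
    (fun m => hhol _ (hcm m)) (hhol _ hcq) (fun K hKs hKc => ?_) (fun ρs ρ hρs hρ hlim => ?_)
    (fun m => (u m).2.2) q.2.2 hZ
  · obtain ⟨M, hM⟩ := hK K hKs hKc
    exact ⟨M, fun m W hW => hM _ (hcm m) W hW⟩
  · have h1 : ∀ m, Sext (u m).1.1 (fun i => (ρs m i : ℂ)) = pointS₀ hE1 hE2 hE0 k (u m).1.1 fun i => (ρs m i : ℂ) :=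
      fun m => hreal _ (hcm m) (ρs m) (hρs m)
    have h2 : Sext q.1.1 (fun i => (ρ i : ℂ)) = pointS₀ hE1 hE2 hE0 k q.1.1 fun i => (ρ i : ℂ) := hreal _ hcq ρ hρ
    simp only [h1, h2]
    have hcont := continuousOn_pointS₀₂ hE1 hE2 hE0 k
    have hmem : (q.1.1, ρ) ∈ (univ : Set (Fin (k + 1) → EuclideanSpace ℝ (Fin d))) ×ˢ {ρ : Fin k → ℝ | ∀ i, 0 < ρ i} :=
      ⟨mem_univ _, hρ⟩
    have hpair : Tendsto (fun m => ((u m).1.1, ρs m)) atTop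
        (𝓝[(univ : Set (Fin (k + 1) → EuclideanSpace ℝ (Fin d))) ×ˢ {ρ : Fin k → ℝ | ∀ i, 0 < ρ i}] (q.1.1, ρ)) :=
      tendsto_nhdsWithin_iff.2 ⟨hc.prodMk_nhds hlim, Eventually.of_forall fun m => ⟨mem_univ _, hρs m⟩⟩
    exact ((hcont _ hmem).tendsto).comp hpair

omit [NeZero d] in
/-- **Compact-uniform bounds from a polynomial bound.** [folklore] -/
theorem exists_compactBound_of_poly {k : ℕ} {R C : ℝ} {e : ℕ}
    {Sext : (Fin (k + 1) → EuclideanSpace ℝ (Fin d)) → (Fin k → ℂ) → ℂ}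
    (hb : ∀ c : Fin (k + 1) → EuclideanSpace ℝ (Fin d), normBall R k c → ∀ ζ : Fin k → ℂ, (∀ i, 0 < (ζ i).re) →
      ‖Sext c ζ‖ ≤ C * (1 + ∑ i, ‖ζ i‖) ^ e * (1 + ∑ i, ((ζ i).re)⁻¹) ^ e) :
    ∀ K ⊆ {Z : Fin k → ℂ | ∀ i, 0 < (Z i).re}, IsCompact K → ∃ M : ℝ,
      ∀ c : Fin (k + 1) → EuclideanSpace ℝ (Fin d), normBall R k c → ∀ W ∈ K, ‖Sext c W‖ ≤ M := by
  intro K hKs hKc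
  have hcont : ContinuousOn (fun W : Fin k → ℂ => C * (1 + ∑ i, ‖W i‖) ^ e * (1 + ∑ i, ((W i).re)⁻¹) ^ e)
      {Z : Fin k → ℂ | ∀ i, 0 < (Z i).re} := by
    refine ((continuousOn_const.mul ((continuousOn_const.add (continuousOn_finsetSum _ fun i _ =>
      (continuous_norm.comp (continuous_apply i)).continuousOn)).pow _)).mul
      ((continuousOn_const.add (continuousOn_finsetSum _ fun i _ => ?_)).pow _))
    exact ((Complex.continuous_re.comp (continuous_apply i)).continuousOn.inv₀ fun W hW => (hW i).ne')
  obtain ⟨M, hM⟩ := hKc.exists_bound_of_continuousOn (hcont.mono hKs)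
  refine ⟨M, fun c hc W hW => (hb c hc W (hKs hW)).trans ?_⟩
  have h := hM W hW
  rw [Real.norm_eq_abs] at h
  exact (le_abs_self _).trans h

end CompactBound

/-! ### The sum-form bound and the tempered families -/

section Assembly

variable {d : ℕ} [NeZero d] {𝔖 : SchwingerFamily (EuclideanSpace ℝ (Fin d))}
  (hE1 : 𝔖.IsEuclideanCovariant) (hE2 : 𝔖.IsOSReflectionPositive) (hE0 : 𝔖.HasLinearGrowth)

/-- **The temperedness estimate (4.5) in the sum form with exponent linear in the number of gaps**
for the Schwinger function values `pointS₀` at labels in the ball of radius `R`: constants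
`α₀ k R^{mk}` with `α₀` of geometric defect `≤ γ^k` (as for the factorially growing `τ_k` of OS II
Thm. 4.1), exponent `t k`. [cite: OsterwalderSchraderCMP1975, §IV.2 Thm. 4.1 (4.5); Ch. VI.2 (6.20)] -/
structure HasPointSumBound (t : ℕ) (γ : ℝ) (m : ℕ) (α₀ : ℕ → ℝ) : Prop where
  one_le : 1 ≤ γ
  nonneg : ∀ k, 0 ≤ α₀ k
  geom : ∀ (k : ℕ) (p : Fin k), Real.sqrt (α₀ (p + 1 + p) * α₀ (k - 1 - p + 1 + (k - 1 - p))) ≤ γ ^ k * α₀ k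
  bound : ∀ R : ℝ, 1 ≤ R → ∀ (k : ℕ) (c : Fin (k + 1) → EuclideanSpace ℝ (Fin d)), normBall R k c →
    ∀ ρ : Fin k → ℝ, (∀ i, 0 < ρ i) →
      ‖pointS₀ hE1 hE2 hE0 k c (fun i => (ρ i : ℂ))‖ ≤ α₀ k * R ^ (m * k) * ((1 + ∑ i, ρ i) * (1 + ∑ i, (ρ i)⁻¹)) ^ (t * k)

variable {hE1 hE2 hE0} {t : ℕ} {γ : ℝ} {m : ℕ} {α₀ : ℕ → ℝ}

/-- `temperedQ` is nonnegative. [folklore] -/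
theorem temperedQ_nonneg (CT γ : ℝ) (hγ : 0 ≤ γ) (t k : ℕ) : 0 ≤ temperedQ CT γ t k := by
  unfold temperedQ
  have h1 : 0 ≤ max 1 CT := zero_le_one.trans (le_max_left _ _)
  have hA : 0 ≤ levA (k - 1) := zero_le_one.trans (levA_spec (k - 1)).1
  positivity

/-- **The tempered labelled families** (OS II Thm. 4.2 with (4.6)) for the labels in the ball of
radius `R ≥ 1`, from the sum-form bound. [cite: OsterwalderSchraderCMP1975, §IV.2 Thm. 4.2 (4.6)] -/
theorem exists_tempered_family (hsb : HasPointSumBound hE1 hE2 hE0 t γ m α₀) {R : ℝ} (hR : 1 ≤ R) :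
    ∃ Sext : (k : ℕ) → (Fin (k + 1) → EuclideanSpace ℝ (Fin d)) → (Fin k → ℂ) → ℂ,
      (∀ (k : ℕ) (c : Fin (k + 1) → EuclideanSpace ℝ (Fin d)), normBall R k c → 0 < k →
        DifferentiableOn ℂ (Sext k c) {Z | ∀ i, 0 < (Z i).re}) ∧
      (∀ (k : ℕ) (c : Fin (k + 1) → EuclideanSpace ℝ (Fin d)), normBall R k c → ∀ ρ : Fin k → ℝ, (∀ i, 0 < ρ i) →
        Sext k c (fun i => (ρ i : ℂ)) = pointS₀ hE1 hE2 hE0 k c (fun i => (ρ i : ℂ))) ∧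
      ∀ k : ℕ, 0 < k → ∀ c : Fin (k + 1) → EuclideanSpace ℝ (Fin d), normBall R k c → ∀ ζ : Fin k → ℂ, (∀ i, 0 < (ζ i).re) →
        ‖Sext k c ζ‖ ≤ α₀ k * R ^ (m * k) * temperedQ 1 γ t k * (1 + ∑ i, ‖ζ i‖) ^ temperedE 1 γ t k *
          (1 + ∑ i, ((ζ i).re)⁻¹) ^ temperedE 1 γ t k := by
  have hR0 : 0 < R := lt_of_lt_of_le one_pos hR
  have hT := isOSSemigroup_holoShiftH (hE2 := hE2) hE1
  have hΦ := isOSLabelledVectors_labVec (hE2 := hE2) hE1 hE0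
  have hgood := isOSLabelSet_normBall (d := d) R
  have hD := isOSLabelledRealData_point hE1 hE2 hE0 R
  have hα : ∀ k, 0 ≤ α₀ k * R ^ (m * k) := fun k => mul_nonneg (hsb.nonneg k) (by positivity)
  have hsum : ∀ (k : ℕ) (c : Fin (k + 1) → EuclideanSpace ℝ (Fin d)), normBall R k c → ∀ ρ : Fin k → ℝ, (∀ i, 0 < ρ i) →
      ‖pointS₀ hE1 hE2 hE0 k c (fun i => (ρ i : ℂ))‖ ≤
        (fun k => α₀ k * R ^ (m * k)) k * ((1 + ∑ i, ρ i) * (1 + ∑ i, (ρ i)⁻¹)) ^ (t * k) :=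
    fun k c hc ρ hρ => hsb.bound R hR k c hc ρ hρ
  have hα2 : ∀ (k : ℕ) (p : Fin k), Real.sqrt ((fun k => α₀ k * R ^ (m * k)) (p + 1 + p) *
      (fun k => α₀ k * R ^ (m * k)) (k - 1 - p + 1 + (k - 1 - p))) ≤ γ ^ k * (fun k => α₀ k * R ^ (m * k)) k := by
    intro k p
    have hrs : ((p : ℕ) + 1 + p) + (k - 1 - p + 1 + (k - 1 - p)) = 2 * k := by have := p.2; omega
    simp only
    have hpow : R ^ (m * (p + 1 + p)) * R ^ (m * (k - 1 - p + 1 + (k - 1 - p))) = (R ^ (m * k)) ^ 2 := by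
      rw [← pow_add, ← mul_add, hrs, show m * (2 * k) = m * k * 2 by ring, pow_mul]
    have hprod : α₀ (p + 1 + p) * R ^ (m * (p + 1 + p)) * (α₀ (k - 1 - p + 1 + (k - 1 - p)) * R ^ (m * (k - 1 - p + 1 + (k - 1 - p)))) =
        (α₀ (p + 1 + p) * α₀ (k - 1 - p + 1 + (k - 1 - p))) * (R ^ (m * k)) ^ 2 := by rw [← hpow]; ring
    rw [hprod, Real.sqrt_mul' _ (sq_nonneg _), Real.sqrt_sq (by positivity)]
    calc Real.sqrt (α₀ (p + 1 + p) * α₀ (k - 1 - p + 1 + (k - 1 - p))) * R ^ (m * k)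
        ≤ (γ ^ k * α₀ k) * R ^ (m * k) := mul_le_mul_of_nonneg_right (hsb.geom k p) (by positivity)
      _ = γ ^ k * (α₀ k * R ^ (m * k)) := by ring
  obtain ⟨Sext, hhol, hreal, hb⟩ := hD.exists_tempered_tower_explicit hT hΦ hgood hα hsum hsb.one_le hα2
  exact ⟨Sext, hhol, hreal, fun k hk c hc ζ hζ => by simpa [mul_assoc] using hb k hk c hc ζ hζ⟩

/-! ### Gluing the families over the radii -/

/-- The chosen tempered family at radius `R + 1`. [folklore] -/
def famR (hsb : HasPointSumBound hE1 hE2 hE0 t γ m α₀) (R : ℕ) :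
    (k : ℕ) → (Fin (k + 1) → EuclideanSpace ℝ (Fin d)) → (Fin k → ℂ) → ℂ :=
  Classical.choose (exists_tempered_family hsb (R := (R : ℝ) + 1) (by simp))

/-- Its properties. [folklore] -/
theorem famR_spec (hsb : HasPointSumBound hE1 hE2 hE0 t γ m α₀) (R : ℕ) :
    (∀ (k : ℕ) (c : Fin (k + 1) → EuclideanSpace ℝ (Fin d)), normBall ((R : ℝ) + 1) k c → 0 < k →
        DifferentiableOn ℂ (famR hsb R k c) {Z | ∀ i, 0 < (Z i).re}) ∧
      (∀ (k : ℕ) (c : Fin (k + 1) → EuclideanSpace ℝ (Fin d)), normBall ((R : ℝ) + 1) k c → ∀ ρ : Fin k → ℝ, (∀ i, 0 < ρ i) →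
        famR hsb R k c (fun i => (ρ i : ℂ)) = pointS₀ hE1 hE2 hE0 k c (fun i => (ρ i : ℂ))) ∧
      ∀ k : ℕ, 0 < k → ∀ c : Fin (k + 1) → EuclideanSpace ℝ (Fin d), normBall ((R : ℝ) + 1) k c →
        ∀ ζ : Fin k → ℂ, (∀ i, 0 < (ζ i).re) →
          ‖famR hsb R k c ζ‖ ≤ α₀ k * ((R : ℝ) + 1) ^ (m * k) * temperedQ 1 γ t k * (1 + ∑ i, ‖ζ i‖) ^ temperedE 1 γ t k *
            (1 + ∑ i, ((ζ i).re)⁻¹) ^ temperedE 1 γ t k :=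
  Classical.choose_spec (exists_tempered_family hsb (R := (R : ℝ) + 1) (by simp))

/-- The radius index of a label vector. [folklore] -/
def radN {k : ℕ} (c : Fin (k + 1) → EuclideanSpace ℝ (Fin d)) : ℕ := ⌈‖c‖⌉₊

omit [NeZero d] in
/-- A label vector lies in the ball of its radius index plus one. [folklore] -/
theorem normBall_radN {k : ℕ} (c : Fin (k + 1) → EuclideanSpace ℝ (Fin d)) : normBall ((radN c : ℝ) + 1) k c := fun j =>
  (norm_le_pi_norm c j).trans ((Nat.le_ceil ‖c‖).trans (by simp [radN]))

/-- **The glued continuation**: the family at the radius of the label vector. [cite: OsterwalderSchraderCMP1975, §IV.2 Thm. 4.2] -/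
def glued (hsb : HasPointSumBound hE1 hE2 hE0 t γ m α₀) (k : ℕ) (c : Fin (k + 1) → EuclideanSpace ℝ (Fin d))
    (ζ : Fin k → ℂ) : ℂ :=
  famR hsb (radN c) k c ζ

/-- The families at different radii agree (uniqueness of the continuation). [folklore] -/
theorem famR_eqOn (hsb : HasPointSumBound hE1 hE2 hE0 t γ m α₀) {R R' : ℕ} {k : ℕ} (hk : 0 < k)
    {c : Fin (k + 1) → EuclideanSpace ℝ (Fin d)} (hc : normBall ((R : ℝ) + 1) k c) (hc' : normBall ((R' : ℝ) + 1) k c) :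
    EqOn (famR hsb R k c) (famR hsb R' k c) {Z | ∀ i, 0 < (Z i).re} :=
  eqOn_re_pos_of_eqOn_posReal ((famR_spec hsb R).1 k c hc hk) ((famR_spec hsb R').1 k c hc' hk) fun η hη => by
    rw [(famR_spec hsb R).2.1 k c hc η hη, (famR_spec hsb R').2.1 k c hc' η hη]

/-- The glued continuation is the family at any admissible radius. [folklore] -/
theorem glued_eq_famR (hsb : HasPointSumBound hE1 hE2 hE0 t γ m α₀) {R : ℕ} {k : ℕ} (hk : 0 < k)
    {c : Fin (k + 1) → EuclideanSpace ℝ (Fin d)} (hc : normBall ((R : ℝ) + 1) k c) {ζ : Fin k → ℂ} (hζ : ∀ i, 0 < (ζ i).re) :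
    glued hsb k c ζ = famR hsb R k c ζ :=
  famR_eqOn hsb hk (normBall_radN c) hc hζ

/-- Holomorphy of the glued continuation. [folklore] -/
theorem differentiableOn_glued (hsb : HasPointSumBound hE1 hE2 hE0 t γ m α₀) {k : ℕ} (hk : 0 < k)
    (c : Fin (k + 1) → EuclideanSpace ℝ (Fin d)) : DifferentiableOn ℂ (glued hsb k c) {Z | ∀ i, 0 < (Z i).re} :=
  (famR_spec hsb (radN c)).1 k c (normBall_radN c) hk

/-- Real values of the glued continuation. [folklore] -/
theorem glued_ofReal (hsb : HasPointSumBound hE1 hE2 hE0 t γ m α₀) {k : ℕ} (c : Fin (k + 1) → EuclideanSpace ℝ (Fin d))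
    {ρ : Fin k → ℝ} (hρ : ∀ i, 0 < ρ i) : glued hsb k c (fun i => (ρ i : ℂ)) = pointS₀ hE1 hE2 hE0 k c (fun i => (ρ i : ℂ)) :=
  (famR_spec hsb (radN c)).2.1 k c (normBall_radN c) ρ hρ

/-- Invariance of the glued continuation under a common translation of the labels. [folklore] -/
theorem glued_add_const (hsb : HasPointSumBound hE1 hE2 hE0 t γ m α₀) {k : ℕ} (hk : 0 < k)
    (c : Fin (k + 1) → EuclideanSpace ℝ (Fin d)) (a : EuclideanSpace ℝ (Fin d)) {ζ : Fin k → ℂ} (hζ : ∀ i, 0 < (ζ i).re) :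
    glued hsb k (fun j => c j + a) ζ = glued hsb k c ζ :=
  eqOn_re_pos_of_eqOn_posReal (differentiableOn_glued hsb hk _) (differentiableOn_glued hsb hk _) (fun η hη => by
    rw [glued_ofReal hsb _ hη, glued_ofReal hsb _ hη]
    exact pointS₀_add_const hE1 hE2 hE0 k c a fun i => by simpa using hη i) hζ

/-- **The polynomial bound of the glued continuation, including the size of the labels.** [cite: OsterwalderSchraderCMP1975, §IV.2 (4.6)] -/
theorem norm_glued_le (hsb : HasPointSumBound hE1 hE2 hE0 t γ m α₀) {k : ℕ} (hk : 0 < k)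
    (c : Fin (k + 1) → EuclideanSpace ℝ (Fin d)) {ζ : Fin k → ℂ} (hζ : ∀ i, 0 < (ζ i).re) :
    ‖glued hsb k c ζ‖ ≤ (α₀ k * (2 : ℝ) ^ (m * k) * temperedQ 1 γ t k) * (1 + ‖c‖) ^ (m * k + temperedE 1 γ t k) *
      (1 + ∑ i, ‖ζ i‖) ^ (m * k + temperedE 1 γ t k) * (1 + ∑ i, ((ζ i).re)⁻¹) ^ (m * k + temperedE 1 γ t k) := by
  have h := (famR_spec hsb (radN c)).2.2 k hk c (normBall_radN c) ζ hζ
  have hQ : 0 ≤ temperedQ 1 γ t k := temperedQ_nonneg 1 γ (zero_le_one.trans hsb.one_le) t k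
  have hα0 := hsb.nonneg k
  set e : ℕ := temperedE 1 γ t k with he
  set A : ℝ := 1 + ∑ i, ‖ζ i‖ with hA
  set B : ℝ := 1 + ∑ i, ((ζ i).re)⁻¹ with hB
  have hA1 : 1 ≤ A := by rw [hA]; have : 0 ≤ ∑ i, ‖ζ i‖ := Finset.sum_nonneg fun i _ => norm_nonneg _; linarith
  have hB1 : 1 ≤ B := by
    rw [hB]; have : 0 ≤ ∑ i, ((ζ i).re)⁻¹ := Finset.sum_nonneg fun i _ => (inv_pos.2 (hζ i)).le; linarith
  have hc1 : 1 ≤ 1 + ‖c‖ := by have := norm_nonneg c; linarith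
  -- the radius
  have hrad : (radN c : ℝ) + 1 ≤ 2 * (1 + ‖c‖) := by
    have h1 : (radN c : ℝ) < ‖c‖ + 1 := Nat.ceil_lt_add_one (norm_nonneg _)
    linarith
  have hradpow : ((radN c : ℝ) + 1) ^ (m * k) ≤ (2 : ℝ) ^ (m * k) * (1 + ‖c‖) ^ (m * k) := by
    rw [← mul_pow]; exact pow_le_pow_left₀ (by positivity) hrad _
  calc ‖glued hsb k c ζ‖ = ‖famR hsb (radN c) k c ζ‖ := rfl
    _ ≤ α₀ k * ((radN c : ℝ) + 1) ^ (m * k) * temperedQ 1 γ t k * A ^ e * B ^ e := h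
    _ ≤ α₀ k * ((2 : ℝ) ^ (m * k) * (1 + ‖c‖) ^ (m * k)) * temperedQ 1 γ t k * A ^ (m * k + e) * B ^ (m * k + e) := by
        gcongr
        · exact Nat.le_add_left e (m * k)
        · exact Nat.le_add_left e (m * k)
    _ ≤ α₀ k * ((2 : ℝ) ^ (m * k) * (1 + ‖c‖) ^ (m * k + e)) * temperedQ 1 γ t k * A ^ (m * k + e) * B ^ (m * k + e) := by
        gcongr
        exact Nat.le_add_right (m * k) e
    _ = (α₀ k * (2 : ℝ) ^ (m * k) * temperedQ 1 γ t k) * (1 + ‖c‖) ^ (m * k + e) * A ^ (m * k + e) * B ^ (m * k + e) := by ring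

/-- **Joint continuity of the glued continuation** in (labels, gaps). [cite: OsterwalderSchraderCMP1975, Ch. V.2 p. 294] -/
theorem continuousOn_glued (hsb : HasPointSumBound hE1 hE2 hE0 t γ m α₀) {k : ℕ} (hk : 0 < k) :
    ContinuousOn (fun q : (Fin (k + 1) → EuclideanSpace ℝ (Fin d)) × (Fin k → ℂ) => glued hsb k q.1 q.2)
      (univ ×ˢ {Z | ∀ i, 0 < (Z i).re}) := by
  intro q₀ hq₀
  set R₁ : ℕ := radN q₀.1 + 1 with hR₁
  -- the family at radius `R₁ + 1` near `q₀`
  set f : (Fin (k + 1) → EuclideanSpace ℝ (Fin d)) × (Fin k → ℂ) → ℂ := fun q => famR hsb R₁ k q.1 q.2 with hf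
  have hfc : ContinuousOn f ({c | ∀ j, ‖c j‖ < (R₁ : ℝ) + 1} ×ˢ {Z | ∀ i, 0 < (Z i).re}) :=
    continuousOn_labelled_of_compactBound hE1 hE2 hE0 (fun c hc => (famR_spec hsb R₁).1 k c hc hk)
      (fun c hc ρ hρ => (famR_spec hsb R₁).2.1 k c hc ρ hρ)
      (exists_compactBound_of_poly fun c hc ζ hζ => (famR_spec hsb R₁).2.2 k hk c hc ζ hζ)
  -- labels near `q₀.1` lie in the open ball of radius `R₁ + 1`
  have hnear : ∀ c : Fin (k + 1) → EuclideanSpace ℝ (Fin d), dist c q₀.1 < 1 → ∀ j, ‖c j‖ < (R₁ : ℝ) + 1 := by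
    intro c hc j
    have h1 : ‖c‖ < ‖q₀.1‖ + 1 := by
      have := norm_le_norm_add_norm_sub' c q₀.1
      rw [← dist_eq_norm] at this; linarith
    have h2 : ‖q₀.1‖ ≤ radN q₀.1 := Nat.le_ceil _
    have h3 : ((R₁ : ℕ) : ℝ) = radN q₀.1 + 1 := by rw [hR₁]; push_cast; ring
    exact (norm_le_pi_norm c j).trans_lt (by linarith)
  have hV : {c : Fin (k + 1) → EuclideanSpace ℝ (Fin d) | ∀ j, ‖c j‖ < (R₁ : ℝ) + 1} ×ˢ {Z : Fin k → ℂ | ∀ i, 0 < (Z i).re} ∈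
      𝓝[univ ×ˢ {Z | ∀ i, 0 < (Z i).re}] q₀ := by
    refine mem_nhdsWithin.2 ⟨ball q₀.1 1 ×ˢ univ, isOpen_ball.prod isOpen_univ, ⟨mem_ball_self one_pos, mem_univ _⟩, ?_⟩
    rintro ⟨c, Z⟩ ⟨⟨hc, -⟩, ⟨-, hZ⟩⟩
    exact ⟨hnear c hc, hZ⟩
  have hq₀V : q₀ ∈ {c : Fin (k + 1) → EuclideanSpace ℝ (Fin d) | ∀ j, ‖c j‖ < (R₁ : ℝ) + 1} ×ˢ {Z : Fin k → ℂ | ∀ i, 0 < (Z i).re} :=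
    ⟨hnear q₀.1 (by simp) , hq₀.2⟩
  have hfq₀ : ContinuousWithinAt f (univ ×ˢ {Z | ∀ i, 0 < (Z i).re}) q₀ := (hfc q₀ hq₀V).mono_of_mem_nhdsWithin hV
  -- the glued function agrees with `f` near `q₀`
  have heq : ∀ q ∈ {c : Fin (k + 1) → EuclideanSpace ℝ (Fin d) | ∀ j, ‖c j‖ < (R₁ : ℝ) + 1} ×ˢ {Z : Fin k → ℂ | ∀ i, 0 < (Z i).re},
      glued hsb k q.1 q.2 = f q := fun q hq =>
    glued_eq_famR hsb hk (fun j => (hq.1 j).le) hq.2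
  refine hfq₀.congr_of_eventuallyEq ?_ (heq q₀ hq₀V)
  exact Filter.mem_of_superset hV fun q hq => heq q hq

/-! ### The theorem -/

/-- **Osterwalder–Schrader II, Theorem 4.3 for a Schwinger family, from the sum-form temperedness
estimate (4.5)**: for a Schwinger family with E0', E1, E2 satisfying `HasPointSumBound` and every
`k'`, there is a function `𝔚` of `k' + 2` complex points with all the properties of (A1):
continuous on the time tube, holomorphic in the times, invariant under real translations, of OS
growth (4.6), and restricting to `𝔖_{k'+2}` on all time-ordered test functions (4.4). [cite: OsterwalderSchraderCMP1975, §IV.2 Thm. 4.3, (4.4), (4.6); Ch. V–VI] -/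
theorem timeContinuation_of_sumBound {d' : ℕ} {S : SchwingerFamily (SpaceTime d')}
    (hE1 : S.IsEuclideanCovariant) (hE2 : S.IsOSReflectionPositive) (hE0 : S.HasLinearGrowth)
    {t : ℕ} {γ : ℝ} {m : ℕ} {α₀ : ℕ → ℝ} (hsb : HasPointSumBound hE1 hE2 hE0 t γ m α₀) (k' : ℕ) :
    ∃ 𝔚 : (Fin (k' + 2) → Fin (d' + 1) → ℂ) → ℂ,
      ContinuousOn 𝔚 (timeTube d' (k' + 2)) ∧ IsTimeHolomorphicOn 𝔚 (timeTube d' (k' + 2)) ∧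
        (∀ z ∈ timeTube d' (k' + 2), ∀ a : SpaceTime d', 𝔚 (fun k => z k + complexifyPoint a) = 𝔚 z) ∧
        HasOSGrowth 𝔚 ∧
        ∀ F : 𝓢((Fin (k' + 2) → SpaceTime d'), ℂ), IsTimeOrdered F →
          S (k' + 2) F = ∫ x : Fin (k' + 2) → SpaceTime d', 𝔚 (euclideanPoint x) * F x := by
  have hk : 0 < k' + 1 := Nat.succ_pos k'
  refine ⟨packW (glued hsb (k' + 1)), timeContinuation_of_labelled hE1 (Sx := glued hsb (k' + 1))
    (fun c => differentiableOn_glued hsb hk c) (continuousOn_glued hsb hk)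
    (fun c a ζ hζ => glued_add_const hsb hk c a hζ) ?_ (isLocalDensity_dens hE1 hE2 hE0 k') ?_ ?_⟩
  · -- the polynomial bound
    refine ⟨α₀ (k' + 1) * (2 : ℝ) ^ (m * (k' + 1)) * temperedQ 1 γ t (k' + 1), m * (k' + 1) + temperedE 1 γ t (k' + 1),
      ?_, fun c ζ hζ => norm_glued_le hsb hk c hζ⟩
    have := hsb.nonneg (k' + 1)
    have := temperedQ_nonneg 1 γ (zero_le_one.trans hsb.one_le) t (k' + 1)
    positivity
  · -- the (4.5)-type bound of the density
    obtain ⟨C, N, -, hb⟩ := exists_bound_dens hE1 hE2 hE0 k'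
    exact ⟨C, N, hb⟩
  · -- the real values are the density values
    intro c ρ hρ
    rw [glued_ofReal hsb c hρ]
    simp only [pointS₀, Complex.ofReal_re]

end Assembly

end Literature.MathematicalPhysics.QuantumFieldTheory
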